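import Mathlib
import Literature.Computability.AlgebraicComplexity.NestFreeMatchingFifo
import Summits.ValiantsHypothesis.ValiantsHypothesis.Theorems.FifoMatchingNNMonotoneHardRank
import HarnessLib

/-!
# Crux `NNMonotoneHard` (stmt-ValiantsHypothesis-11617): the queue of a ballot word and the
# boundary test (piece (C) of `Cruxes/NNMonotoneHard/PROOF-PLAN.md`)

For a word `W : Fin M → Bool` with as many closers as openers (`h`) which is a ballot word
(`IsBallot W h`: the `k`-th opener `o_k` precedes the `k`-th closer `c_k`), the FIFO pairing
`fifo W h` (Literature `NestFreeMatchingFifo.lean`) is read through the two RANKS at time `t`,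
`#openers<t` and `#closers<t`:

* `card_closers_lt_le_card_openers_lt` — ballot ⇒ `#closers<t ≤ #openers<t` (the queue length
  `#openers<t − #closers<t` is nonnegative); `card_openers_lt_add_card_closers_lt` — they add up
  to `t`; `card_closers_lt_succ` — the closer rank steps by one exactly at closers;
* `opener_eq_orderEmbOfFin`, `closer_eq_orderEmbOfFin` — an opener at time `t` is `o_{#openers<t}`,
  a closer at time `t` is `c_{#closers<t}` (so it closes the arc of the FRONT `o_{#closers<t}`);
  `front_lt` — when the queue is nonempty (`#closers<t < #openers<t`) the front opener is `< t`.
* `boundary_test` — **piece (C)**: if `fifo W h` respects a colouring `σ` (every arc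
  monochromatic: `σ (o_k) = σ (c_k)`), then at every colour boundary `σ(s−1) ≠ σ(s)` met with a
  nonempty queue the letter pair `(W(s−1), W(s))` avoids the pattern
  `if σ(front(s−1)) = σ(s) then (D,U) else (U,D)` — a pattern dictated by the strict past.
  (With the test lemma of `FifoMatchingNNMonotoneHardTests.lean` this prices every boundary at
  `3/4` under the uniform measure.)

Honest framing: bookkeeping toward a monotone lower bound for ONE candidate family; VP ≠ VNP is
not moved by anything here.  No definitions, no named facts.
-/

noncomputable section

-- Sub = Summit single-conjunct layout: the duplicated namespace component is mandated by the tree.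
set_option linter.dupNamespace false

namespace Summit.ValiantsHypothesis.ValiantsHypothesis.Theorems.FifoMatching.NNMonotoneHard

open Finset Literature.Computability.AlgebraicComplexity

variable {M : ℕ} {W : Fin M → Bool}

/-- Closers are the non-openers. [folklore] -/
theorem closerSet_eq_compl (W : Fin M → Bool) : closerSet W = (openerSet W)ᶜ := by
  ext i
  simp only [mem_closerSet, mem_compl, mem_openerSet, Bool.not_eq_true]

/-- The two ranks at time `t` add up to `t`. [folklore] -/
theorem card_openers_lt_add_card_closers_lt (W : Fin M → Bool) (t : Fin M) :
    ((openerSet W).filter fun i => i < t).card + ((closerSet W).filter fun i => i < t).card = t := by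
  rw [closerSet_eq_compl]
  exact card_filter_lt_add_compl _ t

/-- The closer rank at time `t` is at most the number of closers. [folklore] -/
theorem card_closers_lt_le (W : Fin M → Bool) (t : Fin M) :
    ((closerSet W).filter fun i => i < t).card ≤ (closerSet W).card :=
  card_filter_le _ _

/-- The opener rank at time `t` is at most the number of openers. [folklore] -/
theorem card_openers_lt_le (W : Fin M → Bool) (t : Fin M) :
    ((openerSet W).filter fun i => i < t).card ≤ (openerSet W).card :=
  card_filter_le _ _

/-- **Ballot ⇒ nonnegative queue length**: at every time `#closers<t ≤ #openers<t`. [folklore] -/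
theorem card_closers_lt_le_card_openers_lt {h : (closerSet W).card = (openerSet W).card}
    (hb : IsBallot W h) (t : Fin M) :
    ((closerSet W).filter fun i => i < t).card ≤ ((openerSet W).filter fun i => i < t).card := by
  by_contra hlt
  rw [not_le] at hlt
  set k := ((openerSet W).filter fun i => i < t).card with hkdef
  have hk : k < (openerSet W).card :=
    lt_of_lt_of_le hlt (by rw [← h]; exact card_closers_lt_le W t)
  have h1 : (closerSet W).orderEmbOfFin h ⟨k, hk⟩ < t := (orderEmbOfFin_lt_iff h ⟨k, hk⟩ t).2 hlt
  have h2 : t ≤ (openerSet W).orderEmbOfFin rfl ⟨k, hk⟩ :=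
    (le_orderEmbOfFin_iff rfl ⟨k, hk⟩ t).2 le_rfl
  exact absurd (hb ⟨k, hk⟩) (not_lt.2 (h1.le.trans h2))

/-- **An opener at time `t` is the `#openers<t`-th opener.** [folklore] -/
theorem opener_eq_orderEmbOfFin {t : Fin M} (ht : W t = true) (k : Fin (openerSet W).card)
    (hk : (k : ℕ) = ((openerSet W).filter fun i => i < t).card) :
    (openerSet W).orderEmbOfFin rfl k = t := by
  have := orderEmbOfFin_card_filter_lt (rfl : (openerSet W).card = _) (mem_openerSet.2 ht)
  convert this using 2
  exact Fin.ext hk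

/-- **A closer at time `t` is the `#closers<t`-th closer** (so it closes the arc opened by the
front `o_{#closers<t}`). [folklore] -/
theorem closer_eq_orderEmbOfFin {h : (closerSet W).card = (openerSet W).card} {t : Fin M}
    (ht : W t = false) (k : Fin (openerSet W).card)
    (hk : (k : ℕ) = ((closerSet W).filter fun i => i < t).card) :
    (closerSet W).orderEmbOfFin h k = t := by
  have := orderEmbOfFin_card_filter_lt h (mem_closerSet.2 ht)
  convert this using 2
  exact Fin.ext hk

/-- **The front of a nonempty queue lies in the past**: if `#closers<t < #openers<t` then the
opener `o_{#closers<t}` (the oldest open arc) is `< t`. [folklore] -/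
theorem front_lt {t : Fin M} (k : Fin (openerSet W).card)
    (hk : (k : ℕ) = ((closerSet W).filter fun i => i < t).card)
    (hq : ((closerSet W).filter fun i => i < t).card < ((openerSet W).filter fun i => i < t).card) :
    (openerSet W).orderEmbOfFin rfl k < t := by
  rw [orderEmbOfFin_lt_iff, hk]
  exact hq

/-- The closer rank steps by one exactly at closers: `#closers<(t+1) = #closers<t + [W t = D]`.
[folklore] -/
theorem card_closers_lt_succ {t t' : Fin M} (htt' : (t' : ℕ) = t + 1) :
    ((closerSet W).filter fun i => i < t').card
      = ((closerSet W).filter fun i => i < t).card + (if W t = false then 1 else 0) := by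
  classical
  have hle : t ≤ t' := Fin.le_def.2 (by omega)
  have hwin := card_filter_lt_sub (closerSet W) hle
  have hset : ((closerSet W).filter fun i => t ≤ i ∧ i < t') =
      (if W t = false then {t} else ∅) := by
    ext i
    simp only [mem_filter, mem_closerSet]
    have : t ≤ i ∧ i < t' ↔ i = t := by
      rw [Fin.le_def, Fin.lt_def, Fin.ext_iff]; omega
    rw [this]
    split_ifs with hW
    · simp only [mem_singleton]
      constructor
      · rintro ⟨-, rfl⟩; rfl
      · rintro rfl; exact ⟨hW, rfl⟩
    · simp only [notMem_empty, iff_false, not_and]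
      rintro hi rfl; exact hW hi
  rw [hset] at hwin
  have hmono := card_filter_lt_mono (closerSet W) hle
  split_ifs at hwin with hW
  · rw [card_singleton] at hwin; rw [if_pos hW]; omega
  · rw [card_empty] at hwin; rw [if_neg hW]; omega

/-- The opener rank steps by one exactly at openers. [folklore] -/
theorem card_openers_lt_succ {t t' : Fin M} (htt' : (t' : ℕ) = t + 1) :
    ((openerSet W).filter fun i => i < t').card
      = ((openerSet W).filter fun i => i < t).card + (if W t = true then 1 else 0) := by
  have h1 := card_openers_lt_add_card_closers_lt W t
  have h2 := card_openers_lt_add_card_closers_lt W t'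
  have h3 := card_closers_lt_succ (W := W) htt'
  cases hW : W t <;> simp [hW] at h3 ⊢ <;> omega

/-! ### Piece (C): the boundary test -/

/-- **The boundary test.**  Let `W` be a ballot word whose FIFO pairing respects the colouring
`σ` (`σ (o_k) = σ (c_k)` for all `k`), and let `s` be a colour boundary (`σ (s−1) ≠ σ s`); let
`k = #closers<(s−1)` be an arc index (it is one when the queue at time `s−1` is nonempty) and
`f = o_k` the front at time `s − 1`: if `σ f = σ s` then `W (s−1) = U` (a closer at `s−1` would close the arc
of `f`, of the wrong colour), and if `σ f ≠ σ s` then `(W(s−1), W s) ≠ (U, D)` (after an opener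
at `s−1` the front is still `f`, and a closer at `s` would close its arc at a time of the other
colour).  In both cases the letter pair avoids a pattern dictated by the strict past.
[folklore] -/
theorem boundary_test {h : (closerSet W).card = (openerSet W).card} (σ : Fin M → Bool)
    (hresp : ∀ k : Fin (openerSet W).card,
      σ ((openerSet W).orderEmbOfFin rfl k) = σ ((closerSet W).orderEmbOfFin h k))
    {s' s : Fin M} (hs : (s : ℕ) = s' + 1) (hσ : σ s' ≠ σ s)
    (k : Fin (openerSet W).card) (hk : (k : ℕ) = ((closerSet W).filter fun i => i < s').card) :
    (W s', W s) ≠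
      (if σ ((openerSet W).orderEmbOfFin rfl k) = σ s then (false, true) else (true, false)) := by
  split_ifs with hf
  · -- the front has the colour of `s`, not of `s'`: no closer at `s'`
    intro hpair
    have hW : W s' = false := (Prod.mk.injEq _ _ _ _ ▸ hpair).1
    have hc : (closerSet W).orderEmbOfFin h k = s' := closer_eq_orderEmbOfFin hW k hk
    have := hresp k
    rw [hc, hf] at this
    exact hσ this.symm
  · -- the front has the colour of `s'`: after an opener at `s'`, no closer at `s`
    intro hpair
    have hW' : W s' = true := (Prod.mk.injEq _ _ _ _ ▸ hpair).1
    have hW : W s = false := (Prod.mk.injEq _ _ _ _ ▸ hpair).2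
    have hstep := card_closers_lt_succ (W := W) hs
    have hk' : (k : ℕ) = ((closerSet W).filter fun i => i < s).card := by
      rw [hstep, hW']; simpa using hk
    have hc : (closerSet W).orderEmbOfFin h k = s := closer_eq_orderEmbOfFin hW k hk'
    have := hresp k
    rw [hc] at this
    -- `σ f = σ s'` since `σ f ≠ σ s` and `σ s' ≠ σ s` (Booleans)
    have hfs' : σ ((openerSet W).orderEmbOfFin rfl k) = σ s' := by
      revert hf hσ; cases σ s' <;> cases σ s <;> cases σ ((openerSet W).orderEmbOfFin rfl k) <;> simp
    exact hσ (hfs'.symm.trans this)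

end Summit.ValiantsHypothesis.ValiantsHypothesis.Theorems.FifoMatching.NNMonotoneHard
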